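import Mathlib
import HarnessLib
import Summits.HubbardSuperconductivity.HubbardSuperconductivity.Theorems.KLProgrammeKLRegimeWickAbsChannels
import Summits.HubbardSuperconductivity.HubbardSuperconductivity.Theorems.KLProgrammeKLRegimeWickLegDressingModel

/-!
# Route `KLProgramme` — ENGINE child (gen-6 `KLRegimeEngineV15`), stub `stub_engine_step_values`, (E2): the ASSEMBLED three-channel identity and
# the external-leg dressing for an ARBITRARY SCALING-INVARIANT even vertex `W` (E2-WICK-ROADMAP §5 (iii-f); cell gate-hubbard-kl, seat p1 g9)

Re-keying of p503245 (`bubbleSum_sixTwo_pairLabels`, `vertexFn_dblFold_bubble_pairLabels`) and p505192 (`oneLineSum_diagContr`,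
`vertexFn_dblFold_oneLine`) to any even `W` invariant under every non-zero vertex-compatible charge scaling (`hWinv`, `hW0`), with the
self-energy entries written out as `vertexFn L M β W 2 (ψ̂⁺_{pσ}, ψ̂⁻_{pσ})` and the pair-kernel entries as `vertexFn L M β W 4 (…)`:
`bubbleSumW_sixTwo`, **`vertexFnW_dblFold_bubble_pairLabels`** (`= 2(βL²)⁻³(PP + PHd − PHx − 2·S62)`), `oneLineSumW_diagContr`,
**`vertexFnW_dblFold_oneLine`** (`= 2(βL²)⁻¹·𝒱₄(W)(Z)·Σ_i ℓ(p_i)·𝒱₂(W)(ψ̂⁺_{p_iσ_i},ψ̂⁻_{p_iσ_i})`).  Instances: `W = 𝒲_n`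
(`klWickAction_scalingInvariant`, `klw_wickAction_mem_evenOdd_zero`) and the continuous route's `W_Λ` (k3c1-p1).  Proved; no definitions.
-/

noncomputable section

namespace Summit.HubbardSuperconductivity.HubbardSuperconductivity.Theorems.KLRegimeWickAbs

set_option linter.dupNamespace false -- summit = problem name (single-conjunct summit), D-0017

open Literature.MathematicalPhysics.QuantumLattice GrassmannAlgebra Finset Matrix
open Literature.Probability.LatticeModels
open Summit.HubbardSuperconductivity.HubbardSuperconductivity.Theorems.TwoPointAssembly
open Summit.HubbardSuperconductivity.HubbardSuperconductivity.Theorems.KLProgrammeLegKernels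
open Summit.HubbardSuperconductivity.HubbardSuperconductivity.Theorems.KLRegimeSplit
open Summit.HubbardSuperconductivity.HubbardSuperconductivity.Theorems.KLRegimeWick

section Model

variable {L M : ℕ} [NeZero L] [NeZero M] (β : ℝ) {W : HubbardGrassmann L M}
  (hWinv : ∀ φ : FreqMomentum L M × Fin 2 → ℂ, (∀ p, φ p ≠ 0) →
    (∀ k₁ k₂ k₃ k₄ : FreqMomentum L M,
      matsubaraInt M k₁.1 + matsubaraInt M k₃.1 = matsubaraInt M k₂.1 + matsubaraInt M k₄.1 ∧ k₁.2 + k₃.2 = k₂.2 + k₄.2 →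
        φ (k₁, 0) * φ (k₃, 1) = φ (k₂, 0) * φ (k₄, 1)) →
    ExteriorAlgebra.map (LinearMap.mulLeft ℂ (scalingWeight φ)) W = W)
include hWinv

/-! ## §1 The `𝒲₆⊗𝒲₂` sum and the assembled identity -/

omit [NeZero M] in
/-- **`bubbleSumW_sixTwo`** — the `𝒲₆⊗𝒲₂` colouring sum of `kernel_dblFold_bubble_self` at any four legs `Z`, for diagonal lines:
`Σ contr C₂ X Y · contr C₁ X' Y' · kernel 𝒲 6 (X,X',Z) · kernel 𝒲 2 (Y,Y') = 2·(c₆c₂)⁻¹·Σ_{p,σ} ℓ₁(p)ℓ₂(p)·𝒱₆(𝒲_n)(ψ̂⁺_{pσ}, ψ̂⁻_{pσ}, Z)·Σ^W_n(p,σ)`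
— both lines sit on the same `(p,σ)` (the two-leg kernel pairs reciprocal labels), the six-leg vertex is closed on itself through the
self-energy-dressed double line. -/
theorem bubbleSumW_sixTwo (hβ : β ≠ 0) {C₁ C₂ : Matrix (HubbardFieldIdx L M) (HubbardFieldIdx L M) ℂ}
    {ℓ₁ ℓ₂ : FreqMomentum L M → ℂ} (h₁ : contr ℂ C₁ = diagContr L M ℓ₁) (h₂ : contr ℂ C₂ = diagContr L M ℓ₂)
    (Z₀ Z₁ Z₂ Z₃ : HubbardFieldIdx L M) :
    ∑ X, ∑ Y, ∑ X', ∑ Y', contr ℂ C₂ X Y * contr ℂ C₁ X' Y' *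
        (kernel ℂ (W) 6 ![X, X', Z₀, Z₁, Z₂, Z₃] * kernel ℂ (W) 2 ![Y, Y']) =
      2 * ((((Nat.factorial 6 : ℝ) * (β * (L : ℝ) ^ 2) ^ 5 : ℝ) : ℂ)⁻¹ * (((Nat.factorial 2 : ℝ) * (β * (L : ℝ) ^ 2) ^ 1 : ℝ) : ℂ)⁻¹) *
        ∑ p : FreqMomentum L M, ∑ σ : Fin 2, ℓ₁ p * ℓ₂ p *
          (vertexFn L M β (W) 6 ![((p, σ), 0), ((p, σ), 1), Z₀, Z₁, Z₂, Z₃] *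
            vertexFn L M β W 2 ![((p, σ), 0), ((p, σ), 1)]) := by
  -- Step 1: line reductions
  rw [h₁, h₂]
  simp_rw [mul_assoc, ← Finset.mul_sum]
  rw [sum_diagContr_mul]
  simp_rw [sum_diagContr_mul]
  -- Step 2: the two-leg kernel pairs only reciprocal labels: equal charges die …
  have hv0 : ∀ (p p' : FreqMomentum L M) (σ σ' : Fin 2), kernel ℂ W 2 ![((p, σ), 0), ((p', σ'), 0)] = 0 :=
    fun p p' σ σ' => kernel_two_plus_eq_zero hWinv p σ (by simp)
  have hv1 : ∀ (p p' : FreqMomentum L M) (σ σ' : Fin 2), kernel ℂ W 2 ![((p, σ), 1), ((p', σ'), 1)] = 0 :=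
    fun p p' σ σ' => kernel_two_minus_eq_zero hWinv p σ (by simp)
  simp only [hv0, hv1, mul_zero, sub_zero, zero_sub, mul_neg, Finset.sum_neg_distrib, Finset.mul_sum]
  -- … and the second line sits on the same `(p, σ)`
  have hc0 : ∀ (p : FreqMomentum L M) (σ : Fin 2) (g : FreqMomentum L M → Fin 2 → ℂ),
      ∑ p' : FreqMomentum L M, ∑ σ' : Fin 2, g p' σ' * kernel ℂ W 2 ![((p, σ), 0), ((p', σ'), 1)] =
        g p σ * kernel ℂ W 2 ![((p, σ), 0), ((p, σ), 1)] := by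
    intro p σ g
    rw [← Fintype.sum_prod_type']
    refine Finset.sum_eq_single (((p, σ)) : FreqMomentum L M × Fin 2) (fun q _ hq => ?_) (fun h => absurd (Finset.mem_univ _) h)
    obtain ⟨p', σ'⟩ := q
    dsimp only
    rw [kernel_two_plus_eq_zero hWinv p σ (fun h => hq (by simpa using h)), mul_zero]
  have hc1 : ∀ (p : FreqMomentum L M) (σ : Fin 2) (g : FreqMomentum L M → Fin 2 → ℂ),
      ∑ p' : FreqMomentum L M, ∑ σ' : Fin 2, g p' σ' * kernel ℂ W 2 ![((p, σ), 1), ((p', σ'), 0)] =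
        g p σ * kernel ℂ W 2 ![((p, σ), 1), ((p, σ), 0)] := by
    intro p σ g
    rw [← Fintype.sum_prod_type']
    refine Finset.sum_eq_single (((p, σ)) : FreqMomentum L M × Fin 2) (fun q _ hq => ?_) (fun h => absurd (Finset.mem_univ _) h)
    obtain ⟨p', σ'⟩ := q
    dsimp only
    rw [kernel_two_minus_eq_zero hWinv p σ (fun h => hq (by simpa using h)), mul_zero]
  refine Finset.sum_congr rfl fun p _ => Finset.sum_congr rfl fun σ _ => ?_
  have e0 : ∑ p' : FreqMomentum L M, ∑ σ' : Fin 2, ℓ₁ p' *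
        (kernel ℂ W 6 ![((p, σ), 1), ((p', σ'), 0), Z₀, Z₁, Z₂, Z₃] * kernel ℂ W 2 ![((p, σ), 0), ((p', σ'), 1)]) =
      ℓ₁ p * kernel ℂ W 6 ![((p, σ), 1), ((p, σ), 0), Z₀, Z₁, Z₂, Z₃] * kernel ℂ W 2 ![((p, σ), 0), ((p, σ), 1)] := by
    simp_rw [← mul_assoc]
    exact hc0 p σ (fun p' σ' => ℓ₁ p' * kernel ℂ W 6 ![((p, σ), 1), ((p', σ'), 0), Z₀, Z₁, Z₂, Z₃])
  have e1 : ∑ p' : FreqMomentum L M, ∑ σ' : Fin 2, ℓ₁ p' *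
        (kernel ℂ W 6 ![((p, σ), 0), ((p', σ'), 1), Z₀, Z₁, Z₂, Z₃] * kernel ℂ W 2 ![((p, σ), 1), ((p', σ'), 0)]) =
      ℓ₁ p * kernel ℂ W 6 ![((p, σ), 0), ((p, σ), 1), Z₀, Z₁, Z₂, Z₃] * kernel ℂ W 2 ![((p, σ), 1), ((p, σ), 0)] := by
    simp_rw [← mul_assoc]
    exact hc1 p σ (fun p' σ' => ℓ₁ p' * kernel ℂ W 6 ![((p, σ), 0), ((p', σ'), 1), Z₀, Z₁, Z₂, Z₃])
  rw [e0, e1, kernel_six_swap01 W ((p, σ), 0) ((p, σ), 1), kernel_two_swap01 W ((p, σ), 0) ((p, σ), 1),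
    kernel_six_eq_inv_mul_vertexFn β hβ W, kernel_two_eq_inv_mul_vertexFn β hβ W]
  ring

/-- **`vertexFn_dblFold_bubble_pairLabels` — the three-channel reading.**  For two copies of the scale-`n` Wick action `𝒲_n` and any two diagonal
lines `C₁, C₂` (values `ℓ₁, ℓ₂`), the quartic vertex function of the folded two-line term at the pair labels `Z = (k′↑+, Q−k′↓+, Q−k↓−, k↑−)` is
`𝒱₄(dblFold(Δ_×(C₁)(Δ_×(C₂)(𝒲_n⁰·𝒲_n¹))))(Z) = 2·(βL²)⁻³·(PP + PHd − PHx − 2·S62)`: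
`PP` the particle–particle loop on the frequency-resolved pair kernel (= `(K·diag λ·K)((k,ω₀),(k′,ω₀))`, `bubbleSum_pp_pairLabels_matrix`),
`PHd` the direct particle–hole loop at transfer `(0, k−k′)`, `PHx` the crossed particle–hole loop at `(2ω₀, k+k′−Q)`, `S62` the `𝒲₆` vertex
closed through the self-energy-dressed double line.  With the step's line values `ℓ = w·βL²·ĝ_K` each `λ` carries `(βL²)²`, so every
channel is a normalised loop sum `(βL²)⁻¹Σ_p`. -/
theorem vertexFnW_dblFold_bubble_pairLabels (hβ : β ≠ 0) (hW0 : W ∈ evenOdd ℂ 0) {C₁ C₂ : Matrix (HubbardFieldIdx L M) (HubbardFieldIdx L M) ℂ}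
    {ℓ₁ ℓ₂ : FreqMomentum L M → ℂ} (h₁ : contr ℂ C₁ = diagContr L M ℓ₁) (h₂ : contr ℂ C₂ = diagContr L M ℓ₂) (Q k k' : TorusSite 2 L) :
    vertexFn L M β (dblFold ℂ (grassmannLaplacian ℂ (crossCov ℂ C₁) (grassmannLaplacian ℂ (crossCov ℂ C₂)
        (dblCopy ℂ 0 (W) * dblCopy ℂ 1 (W))))) 4
        ![(((omega0 M, k'), 0), 0), ((((omega0 M).rev, Q - k'), 1), 0), ((((omega0 M).rev, Q - k), 1), 1), (((omega0 M, k), 0), 1)] =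
      2 * ((((β * (L : ℝ) ^ 2 : ℝ) : ℂ)) ^ 3)⁻¹ *
        ((∑ x : TorusSite 2 L × MatsubaraIdx M,
            (ℓ₂ (x.2, x.1) * ℓ₁ (x.2.rev, Q - x.1) + ℓ₁ (x.2, x.1) * ℓ₂ (x.2.rev, Q - x.1)) *
              (vertexFn L M β W 4 ![(((x.2, x.1), 0), 0), (((x.2.rev, Q - x.1), 1), 0), ((((omega0 M).rev, Q - k), 1), 1), (((omega0 M, k), 0), 1)] *
              vertexFn L M β W 4 ![(((omega0 M, k'), 0), 0), ((((omega0 M).rev, Q - k'), 1), 0), (((x.2.rev, Q - x.1), 1), 1), (((x.2, x.1), 0), 1)])) +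
          (∑ p : FreqMomentum L M, ∑ σ : Fin 2,
            (ℓ₂ p * ℓ₁ (p.1, p.2 + k - k') + ℓ₁ p * ℓ₂ (p.1, p.2 + k - k')) *
              (vertexFn L M β (W) 4
                  ![((p, σ), 1), (((p.1, p.2 + k - k'), σ), 0), (((omega0 M, k'), 0), 0), (((omega0 M, k), 0), 1)] *
                vertexFn L M β (W) 4
                  ![((p, σ), 0), (((p.1, p.2 + k - k'), σ), 1), ((((omega0 M).rev, Q - k'), 1), 0), ((((omega0 M).rev, Q - k), 1), 1)])) -
          (∑ p : FreqMomentum L M, ∑ p' : FreqMomentum L M,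
            if matsubaraInt M p'.1 + 1 = matsubaraInt M p.1 ∧ p'.2 = p.2 + Q - k - k' then
              (ℓ₂ p * ℓ₁ p' + ℓ₁ p * ℓ₂ p') *
                (vertexFn L M β (W) 4
                    ![((p, 0), 1), ((p', 1), 0), (((omega0 M, k'), 0), 0), ((((omega0 M).rev, Q - k), 1), 1)] *
                  vertexFn L M β (W) 4
                    ![((p, 0), 0), ((p', 1), 1), ((((omega0 M).rev, Q - k'), 1), 0), (((omega0 M, k), 0), 1)])
            else 0) -
          2 * ∑ p : FreqMomentum L M, ∑ σ : Fin 2, ℓ₁ p * ℓ₂ p *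
            (vertexFn L M β (W) 6
                ![((p, σ), 0), ((p, σ), 1), (((omega0 M, k'), 0), 0), ((((omega0 M).rev, Q - k'), 1), 0), ((((omega0 M).rev, Q - k), 1), 1),
                  (((omega0 M, k), 0), 1)] *
              vertexFn L M β W 2 ![((p, σ), 0), ((p, σ), 1)])) := by
  have hL : (L : ℝ) ≠ 0 := Nat.cast_ne_zero.2 (NeZero.ne L)
  have hb : (((β * (L : ℝ) ^ 2 : ℝ) : ℂ)) ≠ 0 := by exact_mod_cast mul_ne_zero hβ (pow_ne_zero 2 hL)
  obtain ⟨e4, e6, e2⟩ := vertexFn_consts_eq (L := L) β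
  set Z₀ : HubbardFieldIdx L M := (((omega0 M, k'), 0), 0) with hZ₀
  set Z₁ : HubbardFieldIdx L M := ((((omega0 M).rev, Q - k'), 1), 0) with hZ₁
  set Z₂ : HubbardFieldIdx L M := ((((omega0 M).rev, Q - k), 1), 1) with hZ₂
  set Z₃ : HubbardFieldIdx L M := (((omega0 M, k), 0), 1) with hZ₃
  have hv0 : (![Z₀, Z₁, Z₂, Z₃] : Fin 4 → HubbardFieldIdx L M) 0 = Z₀ := rfl
  have hv1 : (![Z₀, Z₁, Z₂, Z₃] : Fin 4 → HubbardFieldIdx L M) 1 = Z₁ := rfl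
  have hv2 : (![Z₀, Z₁, Z₂, Z₃] : Fin 4 → HubbardFieldIdx L M) 2 = Z₂ := rfl
  have hv3 : (![Z₀, Z₁, Z₂, Z₃] : Fin 4 → HubbardFieldIdx L M) 3 = Z₃ := rfl
  rw [vertexFn_def, show (4 - 1 : ℕ) = 3 from rfl,
    kernel_dblFold_bubble_self ℂ C₁ C₂ (hW0) ![Z₀, Z₁, Z₂, Z₃]]
  simp only [hv0, hv1, hv2, hv3]
  rw [hZ₀, hZ₁, hZ₂, hZ₃, bubbleSumW_pp_pairLabels β hWinv hβ h₁ h₂ Q k k', bubbleSumW_phDirect_pairLabels β hWinv hβ h₁ h₂ Q k k',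
    bubbleSumW_phCrossed_pairLabels β hWinv hβ h₁ h₂ Q k k', bubbleSumW_sixTwo β hWinv hβ h₁ h₂, e4, e6, e2]
  field_simp
  ring


/-! ## §2 External-leg dressing -/

omit [NeZero M] in
/-- **`oneLineSumW_diagContr`** — against a diagonal line the one-line sum localises on the external leg: for either charge of `Zi = ψ̂^±_{pσ}`,
`Σ_{X,Y} diagContr ℓ X Y · kernel 𝒲_n 2 (X, Zi) · kernel 𝒲_n 4 (Y, R) = ℓ(p)·kernel 𝒲_n 2 (ψ̂⁻_{pσ}, ψ̂⁺_{pσ})·kernel 𝒲_n 4 (Zi, R)`. -/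
theorem oneLineSumW_diagContr (ℓ : FreqMomentum L M → ℂ) (Zi : HubbardFieldIdx L M) (R : Fin 3 → HubbardFieldIdx L M) :
    ∑ X, ∑ Y, diagContr L M ℓ X Y * (kernel ℂ (W) 2 ![X, Zi] * kernel ℂ (W) 4 (Matrix.vecCons Y R)) =
      ℓ Zi.1.1 * (kernel ℂ (W) 2 ![(Zi.1, 1), (Zi.1, 0)] *
        kernel ℂ (W) 4 (Matrix.vecCons Zi R)) := by
  rw [sum_diagContr_mul]
  obtain ⟨⟨q, τ⟩, c⟩ := Zi
  -- the two-leg kernel pairs only reciprocal labels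
  have hmm : ∀ (p : FreqMomentum L M) (σ : Fin 2), kernel ℂ W 2 ![((p, σ), 1), ((q, τ), 1)] = 0 :=
    fun p σ => kernel_two_minus_eq_zero hWinv p σ (by simp)
  have hpp : ∀ (p : FreqMomentum L M) (σ : Fin 2), kernel ℂ W 2 ![((p, σ), 0), ((q, τ), 0)] = 0 :=
    fun p σ => kernel_two_plus_eq_zero hWinv p σ (by simp)
  fin_cases c
  · -- `Zi = ψ̂⁺_{qτ}`: only the `ψ̂⁻` end of the line can sit on it
    simp only [Fin.zero_eta, Fin.isValue, hpp, zero_mul, sub_zero]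
    rw [← Fintype.sum_prod_type']
    rw [Finset.sum_eq_single (((q, τ)) : FreqMomentum L M × Fin 2) (fun x _ hx => ?_) (fun h => absurd (Finset.mem_univ _) h)]
    obtain ⟨p, σ⟩ := x
    dsimp only
    rw [kernel_two_minus_eq_zero hWinv p σ (fun h => hx (by simpa using h.symm)), zero_mul, mul_zero]
  · -- `Zi = ψ̂⁻_{qτ}`: only the `ψ̂⁺` end
    simp only [Fin.mk_one, Fin.isValue, hmm, zero_mul, zero_sub, mul_neg]
    rw [← Fintype.sum_prod_type']
    rw [Finset.sum_eq_single (((q, τ)) : FreqMomentum L M × Fin 2) (fun x _ hx => ?_) (fun h => absurd (Finset.mem_univ _) h)]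
    · dsimp only
      rw [kernel_two_swap01 W ((q, τ), 1) ((q, τ), 0)]
      ring
    · obtain ⟨p, σ⟩ := x
      dsimp only
      rw [kernel_two_plus_eq_zero hWinv p σ (fun h => hx (by simpa using h.symm)), zero_mul, mul_zero, neg_zero]

omit [NeZero M] in
/-- **`vertexFnW_dblFold_oneLine` — external-leg dressing, exactly.**  For the Wick action `𝒲_n`, any diagonal line `C` (values `ℓ`) and ANY four
external legs `Z = (ψ̂^{c_i}_{p_iσ_i})_{i<4}`:
`𝒱₄(dblFold(Δ_×(C)(𝒲_n⁰·𝒲_n¹)))(Z) = 2·(βL²)⁻¹ · 𝒱₄(𝒲_n)(Z) · Σ_{i<4} ℓ(p_i)·Σ^W_n(p_i, σ_i)`. -/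
theorem vertexFnW_dblFold_oneLine (hβ : β ≠ 0) (hW0 : W ∈ evenOdd ℂ 0) {C : Matrix (HubbardFieldIdx L M) (HubbardFieldIdx L M) ℂ} {ℓ : FreqMomentum L M → ℂ}
    (hC : contr ℂ C = diagContr L M ℓ) (Z : Fin 4 → HubbardFieldIdx L M) :
    vertexFn L M β (dblFold ℂ (grassmannLaplacian ℂ (crossCov ℂ C)
        (dblCopy ℂ 0 (W) * dblCopy ℂ 1 (W)))) 4 Z =
      2 * (((β * (L : ℝ) ^ 2 : ℝ) : ℂ))⁻¹ * vertexFn L M β (W) 4 Z *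
        ∑ i : Fin 4, ℓ (Z i).1.1 * vertexFn L M β W 2 ![((Z i).1, 0), ((Z i).1, 1)] := by
  have hL : (L : ℝ) ≠ 0 := Nat.cast_ne_zero.2 (NeZero.ne L)
  have hb : (((β * (L : ℝ) ^ 2 : ℝ) : ℂ)) ≠ 0 := by exact_mod_cast mul_ne_zero hβ (pow_ne_zero 2 hL)
  obtain ⟨e4, -, e2⟩ := vertexFn_consts_eq (L := L) β
  have hZ : (![Z 0, Z 1, Z 2, Z 3] : Fin 4 → HubbardFieldIdx L M) = Z := by funext i; fin_cases i <;> rfl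
  rw [vertexFn_def, show (4 - 1 : ℕ) = 3 from rfl, kernel_dblFold_oneLine_self ℂ C (hW0) Z, hC,
    oneLineSumW_diagContr hWinv ℓ (Z 0) ![Z 1, Z 2, Z 3], oneLineSumW_diagContr hWinv ℓ (Z 1) ![Z 0, Z 2, Z 3],
    oneLineSumW_diagContr hWinv ℓ (Z 2) ![Z 0, Z 1, Z 3], oneLineSumW_diagContr hWinv ℓ (Z 3) ![Z 0, Z 1, Z 2]]
  rw [show (Matrix.vecCons (Z 0) ![Z 1, Z 2, Z 3] : Fin 4 → HubbardFieldIdx L M) = ![Z 0, Z 1, Z 2, Z 3] from rfl,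
    show (Matrix.vecCons (Z 1) ![Z 0, Z 2, Z 3] : Fin 4 → HubbardFieldIdx L M) = ![Z 1, Z 0, Z 2, Z 3] from rfl,
    show (Matrix.vecCons (Z 2) ![Z 0, Z 1, Z 3] : Fin 4 → HubbardFieldIdx L M) = ![Z 2, Z 0, Z 1, Z 3] from rfl,
    show (Matrix.vecCons (Z 3) ![Z 0, Z 1, Z 2] : Fin 4 → HubbardFieldIdx L M) = ![Z 3, Z 0, Z 1, Z 2] from rfl,
    kernel_four_swap01 W (Z 0) (Z 1), kernel_four_rot3 W (Z 0) (Z 1) (Z 2), kernel_four_rot4 W (Z 0) (Z 1) (Z 2), hZ]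
  simp only [Fin.sum_univ_four]
  rw [kernel_two_swap01 _ ((Z 0).1, 0) ((Z 0).1, 1), kernel_two_swap01 _ ((Z 1).1, 0) ((Z 1).1, 1),
    kernel_two_swap01 _ ((Z 2).1, 0) ((Z 2).1, 1), kernel_two_swap01 _ ((Z 3).1, 0) ((Z 3).1, 1),
    kernel_two_eq_inv_mul_vertexFn β hβ, kernel_two_eq_inv_mul_vertexFn β hβ, kernel_two_eq_inv_mul_vertexFn β hβ,
    kernel_two_eq_inv_mul_vertexFn β hβ, kernel_four_eq_inv_mul_vertexFn β hβ, e4, e2]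
  field_simp
  ring

end Model

end Summit.HubbardSuperconductivity.HubbardSuperconductivity.Theorems.KLRegimeWickAbs

end
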